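import Literature.RingTheory.CompleteLocalRings.WittVectorLifts
import Mathlib.RingTheory.Derivation.ToSquareZero
import Mathlib.RingTheory.Ideal.Quotient.PowTransition
import Mathlib.RingTheory.AdicCompletion.RingHom
import HarnessLib

/-!
# Residue discs of smooth points in `W(κ)` are uncountable (Hensel's lemma with a free parameter)

Topic `Literature/RingTheory/CompleteLocalRings`. The classical fact behind the `p`-adic disc
arguments (Cassels 1976, proof of Thm. I: "since `ℤ_p` is uncountable … choose `ξ` in the residue
class"; Maulik–Poonen 2012, §4: the `W`-points of a smooth scheme reducing to a given `𝔽̄_p`-point form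
a non-trivial `p`-adic disc): if `A` is a formally smooth `Λ`-algebra, `Λ → W(κ)`, `x̄ : A → κ` a point
compatible with `Λ → W(κ) → κ`, and the point is NOT étale — witnessed by a non-zero `Λ`-derivation
`δ : A → κ` at `x̄` — then the set of `Λ`-algebra lifts `x : A → W(κ)` of `x̄` is UNCOUNTABLE.

Proof (deformation theory, SGA1 III / Illusie): the lifts of a `Λ`-map `A → W/pⁿ⁺¹` to `W/pⁿ⁺²`
form a torsor under `Der_Λ(A, pⁿ⁺¹W/pⁿ⁺²W) ≅ Der_Λ(A, κ)` (Mathlib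
`liftOfDerivationToSquareZero`), non-empty by formal smoothness (`Algebra.FormallySmooth.lift`);
`c ↦ [c]·pⁿ⁺¹` embeds `κ` into `pⁿ⁺¹W/pⁿ⁺²W` (`κ` perfect), so `δ` gives a second lift at every
level; the binary tree of choices yields `2^ℕ` pairwise distinct compatible towers, each of which is
the reduction tower of a `Λ`-map `A → W(κ)` (`W(κ)` is `p`-adically complete, Mathlib
`IsAdicComplete.StrictMono.liftRingHom`), and `2^ℕ` is uncountable (Cantor).

* `not_countable_lifts_wittVector` — the statement above (`κ` a perfect integral domain of
  characteristic `p`).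

## References

* [Cassels1976] J. W. S. Cassels, An embedding theorem for fields, Bull. Austral. Math. Soc. 14
  (1976), proof of Thm. I.
* [MaulikPoonen2012] D. Maulik, B. Poonen, Néron–Severi groups under specialization, Duke Math.
  J. 161 (2012), §4 (residue discs of `W`-points).
* [Matsumura1987] H. Matsumura, Commutative Ring Theory, §25 (derivations and extensions,
  Thm. 25.1–25.2) and Thm. 28.10 / 29.2 (lifting through nilpotent and complete ideals).
-/

noncomputable section

universe u v w

namespace Literature.RingTheory.CompleteLocalRings

open WittVector

variable {p : ℕ} [hp : Fact p.Prime] {κ : Type v} [CommRing κ]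

/-! ## The ideals `pⁿ⁺¹ W(κ)` and the reductions `W/pⁿ⁺¹ → κ` -/

/-- `(p)ⁿ⁺² ⊆ (p)ⁿ⁺¹`. [folklore] -/
private theorem P_le (n : ℕ) : (Ideal.span {(p : WittVector p κ)} ^ (n + 1 + 1)) ≤ (Ideal.span {(p : WittVector p κ)} ^ (n + 1)) :=
  Ideal.pow_le_pow_right (Nat.le_succ _)

/-- `(p)ⁿ⁺¹ ⊆ (p)`. [folklore] -/
private theorem P_le_span (n : ℕ) : (Ideal.span {(p : WittVector p κ)} ^ (n + 1)) ≤ Ideal.span {(p : WittVector p κ)} :=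
  Ideal.pow_le_self (Nat.succ_ne_zero n)

/-- `((p)ⁿ⁺¹)² ⊆ (p)ⁿ⁺²`. [folklore] -/
private theorem P_sq_le (n : ℕ) : (Ideal.span {(p : WittVector p κ)} ^ (n + 1)) ^ 2 ≤ (Ideal.span {(p : WittVector p κ)} ^ (n + 1 + 1)) := by
  rw [← pow_mul]
  exact Ideal.pow_le_pow_right (by omega)

/-- `w · pⁿ⁺¹ ∈ (p)ⁿ⁺¹`. [folklore] -/
private theorem mul_pow_mem_pow (w : WittVector p κ) (n : ℕ) :
    w * (p : WittVector p κ) ^ (n + 1) ∈ Ideal.span {(p : WittVector p κ)} ^ (n + 1) := by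
  rw [Ideal.span_singleton_pow]
  exact Ideal.mul_mem_left _ _ (Ideal.mem_span_singleton_self _)

section Perfect

variable [CharP κ p] [PerfectRing κ p]

/-- Membership in `(p)ⁿ ⊆ W(κ)` is vanishing of the first `n` Witt coordinates (Mathlib
`WittVector.mem_span_p_pow_iff_le_coeff_eq_zero`, restated for the power of the ideal). [folklore] -/
private theorem mem_span_p_pow_iff (x : WittVector p κ) (n : ℕ) :
    x ∈ Ideal.span {(p : WittVector p κ)} ^ n ↔ ∀ m, m < n → x.coeff m = 0 := by
  rw [Ideal.span_singleton_pow]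
  exact WittVector.mem_span_p_pow_iff_le_coeff_eq_zero x n

/-- Two Witt vectors congruent modulo `(p)ⁿ⁺¹` have the same zeroth coordinate. [folklore] -/
private theorem constantCoeff_eq_of_mk_eq {n : ℕ} {w w' : WittVector p κ}
    (h : Ideal.Quotient.mk (Ideal.span {(p : WittVector p κ)} ^ (n + 1)) w = Ideal.Quotient.mk (Ideal.span {(p : WittVector p κ)} ^ (n + 1)) w') :
    WittVector.constantCoeff w = WittVector.constantCoeff w' := by
  have h1 : w - w' ∈ Ideal.span {(p : WittVector p κ)} := P_le_span n (Ideal.Quotient.eq.mp h)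
  rw [WittVector.mem_span_p_iff_coeff_zero_eq_zero] at h1
  rw [← sub_eq_zero, ← map_sub]
  exact h1

variable [IsDomain κ]

/-- `w · pⁿ⁺¹ ∈ (p)ⁿ⁺²` iff the zeroth coordinate of `w` vanishes (`κ` reduced). [folklore] -/
private theorem mul_pow_mem_pow_succ_iff (w : WittVector p κ) (n : ℕ) :
    w * (p : WittVector p κ) ^ (n + 1) ∈ Ideal.span {(p : WittVector p κ)} ^ (n + 2) ↔
      w.coeff 0 = 0 := by
  rw [mem_span_p_pow_iff]
  constructor
  · intro h
    have h1 := h (0 + (n + 1)) (by omega)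
    rw [WittVector.mul_pow_charP_coeff_succ] at h1
    exact (pow_eq_zero_iff (pow_ne_zero _ hp.out.ne_zero)).mp h1
  · intro h m hm
    rcases Nat.lt_or_ge m (n + 1) with hlt | hge
    · exact WittVector.mul_pow_charP_coeff_zero _ hlt
    · obtain rfl : m = 0 + (n + 1) := by omega
      rw [WittVector.mul_pow_charP_coeff_succ, h, zero_pow (pow_ne_zero _ hp.out.ne_zero)]

end Perfect

/-! ## One step: two distinct lifts through `W/pⁿ⁺² → W/pⁿ⁺¹` -/

section Step

variable [CharP κ p] [PerfectRing κ p] [IsDomain κ]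
variable {Λ : Type u} [CommRing Λ] [Algebra Λ (WittVector p κ)]
variable {A : Type w} [CommRing A] [Algebra Λ A]

/-- **The deformation step.** For a `Λ`-algebra map `g : A → W/pⁿ⁺¹` reducing to `x̄` there are two
DISTINCT `Λ`-algebra lifts `A → W/pⁿ⁺²` of `g`, provided `A` is formally smooth over `Λ` and
`x̄` carries a non-zero `Λ`-derivation `δ : A → κ` (lifts form a torsor under the derivations into
`pⁿ⁺¹W/pⁿ⁺²W ⊇ [κ]·pⁿ⁺¹`; Matsumura §25, SGA1 III 5.1). [cite: Matsumura1987, Thm. 25.1 and §28 (p. 213)] -/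
private theorem exists_two_lifts [Algebra.FormallySmooth Λ A] (xbar : A →+* κ)
    (δ : A → κ) (hδadd : ∀ a b, δ (a + b) = δ a + δ b)
    (hδmul : ∀ a b, δ (a * b) = xbar a * δ b + xbar b * δ a)
    (hδΛ : ∀ l : Λ, δ (algebraMap Λ A l) = 0) {a₀ : A} (ha₀ : δ a₀ ≠ 0) (n : ℕ)
    (g : A →ₐ[Λ] WittVector p κ ⧸ (Ideal.span {(p : WittVector p κ)} ^ (n + 1)))
    (hg : ∀ a w, g a = Ideal.Quotient.mk (Ideal.span {(p : WittVector p κ)} ^ (n + 1)) w → WittVector.constantCoeff w = xbar a) :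
    ∃ G₀ G₁ : A →ₐ[Λ] WittVector p κ ⧸ (Ideal.span {(p : WittVector p κ)} ^ (n + 1 + 1)),
      (Ideal.Quotient.factorₐ Λ (P_le n)).comp G₀ = g ∧
      (Ideal.Quotient.factorₐ Λ (P_le n)).comp G₁ = g ∧ G₀ a₀ ≠ G₁ a₀ := by
  set B := WittVector p κ ⧸ (Ideal.span {(p : WittVector p κ)} ^ (n + 1 + 1)) with hB
  -- the square-zero ideal `K = (Ideal.span {(p : WittVector p κ)} ^ (n + 1)) / (Ideal.span {(p : WittVector p κ)} ^ (n+1 + 1))` of `B`, with `B / K ≅ W / (Ideal.span {(p : WittVector p κ)} ^ (n + 1))`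
  set K : Ideal B := ((Ideal.span {(p : WittVector p κ)} ^ (n + 1))).map (Ideal.Quotient.mkₐ Λ (Ideal.span {(p : WittVector p κ)} ^ (n + 1 + 1))) with hK
  have hK2 : K ^ 2 = ⊥ := by
    have : K = ((Ideal.span {(p : WittVector p κ)} ^ (n + 1))).map (Ideal.Quotient.mk (Ideal.span {(p : WittVector p κ)} ^ (n + 1 + 1))) := rfl
    rw [this, ← Ideal.map_pow]
    exact eq_bot_iff.mpr ((Ideal.map_mono (P_sq_le n)).trans
      (le_of_eq (Ideal.map_quotient_self _)))
  let e : (B ⧸ K) ≃ₐ[Λ] WittVector p κ ⧸ (Ideal.span {(p : WittVector p κ)} ^ (n + 1)) :=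
    DoubleQuot.quotQuotEquivQuotOfLEₐ Λ (P_le n)
  have he : ∀ w : WittVector p κ,
      e (Ideal.Quotient.mk K (Ideal.Quotient.mk (Ideal.span {(p : WittVector p κ)} ^ (n + 1 + 1)) w)) = Ideal.Quotient.mk (Ideal.span {(p : WittVector p κ)} ^ (n + 1)) w :=
    fun w => DoubleQuot.quotQuotEquivQuotOfLE_quotQuotMk w (P_le n)
  have hfac : ∀ b : B, e (Ideal.Quotient.mk K b) = Ideal.Quotient.factor (P_le n) b := by
    intro b
    obtain ⟨w, rfl⟩ := Ideal.Quotient.mk_surjective b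
    exact he w
  -- first lift, by formal smoothness
  let G₀ : A →ₐ[Λ] B := Algebra.FormallySmooth.lift K ⟨2, hK2⟩ (e.symm.toAlgHom.comp g)
  have hG₀K : ∀ a, Ideal.Quotient.mk K (G₀ a) = e.symm (g a) := fun a =>
    Algebra.FormallySmooth.mk_lift K ⟨2, hK2⟩ _ a
  have hG₀ : ∀ a, Ideal.Quotient.factor (P_le n) (G₀ a) = g a := by
    intro a
    rw [← hfac, hG₀K, AlgEquiv.apply_symm_apply]
  have hG₀red : ∀ a w, G₀ a = Ideal.Quotient.mk (Ideal.span {(p : WittVector p κ)} ^ (n + 1 + 1)) w →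
      WittVector.constantCoeff w = xbar a := by
    intro a w hw
    refine hg a w ?_
    rw [← hG₀ a, hw]
    rfl
  -- the embedding `c ↦ [c]·pⁿ⁺¹` of `κ` into `K`
  let ι : κ → B := fun c =>
    Ideal.Quotient.mk (Ideal.span {(p : WittVector p κ)} ^ (n + 1 + 1)) (teichmuller p c * (p : WittVector p κ) ^ (n + 1))
  have hιK : ∀ c, ι c ∈ K := fun c =>
    Ideal.mem_map_of_mem _ (mul_pow_mem_pow (teichmuller p c) n)
  have hι_sub : ∀ w w' : WittVector p κ, w.coeff 0 = w'.coeff 0 →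
      Ideal.Quotient.mk (Ideal.span {(p : WittVector p κ)} ^ (n + 1 + 1)) (w * (p : WittVector p κ) ^ (n + 1)) =
        Ideal.Quotient.mk (Ideal.span {(p : WittVector p κ)} ^ (n + 1 + 1)) (w' * (p : WittVector p κ) ^ (n + 1)) := by
    intro w w' h
    rw [Ideal.Quotient.eq, ← sub_mul, mul_pow_mem_pow_succ_iff]
    change WittVector.constantCoeff (w - w') = 0
    rw [map_sub, sub_eq_zero]
    exact h
  have hιadd : ∀ c d, ι (c + d) = ι c + ι d := by
    intro c d
    change _ = Ideal.Quotient.mk _ _ + Ideal.Quotient.mk _ _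
    rw [← map_add, ← add_mul]
    refine hι_sub _ _ ?_
    rw [WittVector.add_coeff_zero, teichmuller_coeff_zero, teichmuller_coeff_zero,
      teichmuller_coeff_zero]
  have hιmul : ∀ (w : WittVector p κ) (c : κ),
      Ideal.Quotient.mk (Ideal.span {(p : WittVector p κ)} ^ (n + 1 + 1)) w * ι c = ι (w.coeff 0 * c) := by
    intro w c
    change Ideal.Quotient.mk _ _ * Ideal.Quotient.mk _ _ = Ideal.Quotient.mk _ _
    rw [← map_mul, ← mul_assoc]
    refine hι_sub _ _ ?_
    rw [WittVector.mul_coeff_zero, teichmuller_coeff_zero, teichmuller_coeff_zero]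
  have hι0 : ∀ c, ι c = 0 → c = 0 := by
    intro c hc
    have h : teichmuller p c * (p : WittVector p κ) ^ (n + 1) ∈ (Ideal.span {(p : WittVector p κ)} ^ (n + 1 + 1)) :=
      Ideal.Quotient.eq_zero_iff_mem.mp hc
    rw [mul_pow_mem_pow_succ_iff, teichmuller_coeff_zero] at h
    exact h
  -- the derivation `a ↦ ι (δ a)` into `K`, for the `A`-algebra structure `G₀` on `B`
  letI : Algebra A B := G₀.toRingHom.toAlgebra
  haveI : IsScalarTower Λ A B := IsScalarTower.of_algebraMap_eq fun l => (G₀.commutes l).symm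
  have hsmul : ∀ (a : A) (c : κ), (algebraMap A B a) * ι c = ι (xbar a * c) := by
    intro a c
    obtain ⟨w, hw⟩ := Ideal.Quotient.mk_surjective (G₀ a)
    have hw0 : w.coeff 0 = xbar a := by
      rw [← hG₀red a w hw.symm]; exact (WittVector.constantCoeff_apply w).symm
    change G₀ a * ι c = _
    rw [← hw, hιmul, hw0]
  let D : Derivation Λ A K :=
    { toFun := fun a => ⟨ι (δ a), hιK _⟩
      map_add' := fun a b => Subtype.ext (by simp only [hδadd, hιadd, Submodule.coe_add])
      map_smul' := fun l a => Subtype.ext (by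
        change ι (δ (l • a)) = l • ι (δ a)
        rw [Algebra.smul_def, hδmul, hδΛ, mul_zero, add_zero, Algebra.smul_def,
          IsScalarTower.algebraMap_apply Λ A B, hsmul])
      map_one_eq_zero' := Subtype.ext (by
        change ι (δ 1) = 0
        have h1 : δ 1 = 0 := by
          have := hδmul 1 1
          rw [mul_one, map_one, one_mul] at this
          -- δ 1 = δ 1 + δ 1
          have h2 : δ 1 + δ 1 = δ 1 + 0 := by rw [add_zero]; exact this.symm
          exact add_left_cancel h2
        rw [h1]
        have := hιadd 0 0
        rw [add_zero] at this
        -- ι 0 = ι 0 + ι 0 ⇒ ι 0 = 0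
        have h3 : ι 0 + ι 0 = ι 0 + 0 := by rw [add_zero]; exact this.symm
        exact add_left_cancel h3)
      leibniz' := fun a b => Subtype.ext (by
        change ι (δ (a * b)) = ((a • (⟨ι (δ b), hιK _⟩ : K) + b • (⟨ι (δ a), hιK _⟩ : K) : K) : B)
        rw [Submodule.coe_add, Submodule.coe_smul_of_tower, Submodule.coe_smul_of_tower,
          Algebra.smul_def, Algebra.smul_def, hsmul, hsmul, hδmul, hιadd]) }
  let G₁ : A →ₐ[Λ] B := liftOfDerivationToSquareZero K hK2 D
  have hG₁ : ∀ a, Ideal.Quotient.factor (P_le n) (G₁ a) = g a := by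
    intro a
    rw [← hfac, liftOfDerivationToSquareZero_mk_apply, ← Ideal.Quotient.mk_algebraMap]
    change e (Ideal.Quotient.mk K (G₀ a)) = g a
    rw [hfac, hG₀]
  refine ⟨G₀, G₁, AlgHom.ext hG₀, AlgHom.ext hG₁, fun h => ha₀ (hι0 _ ?_)⟩
  have h1 : G₁ a₀ = ι (δ a₀) + G₀ a₀ := liftOfDerivationToSquareZero_apply K hK2 D a₀
  calc ι (δ a₀) = (ι (δ a₀) + G₀ a₀) - G₀ a₀ := by ring
    _ = G₁ a₀ - G₀ a₀ := by rw [h1]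
    _ = 0 := by rw [← h, sub_self]

end Step

/-! ## The binary tree of lifts and the count -/

section Disc

variable [CharP κ p] [PerfectRing κ p] [IsDomain κ]
variable {Λ : Type u} [CommRing Λ] [Algebra Λ (WittVector p κ)]
variable {A : Type w} [CommRing A] [Algebra Λ A]

/-- **Residue discs of non-étale smooth points of `W(κ)`-schemes are uncountable.** Let `κ` be a
perfect integral domain of characteristic `p`, `Λ → W(κ)` a ring map, `A` a formally smooth
`Λ`-algebra, `x̄ : A → κ` a ring map compatible with `Λ → W(κ) → κ`, and `δ : A → κ` a NON-ZERO
`Λ`-derivation at `x̄` (additive, Leibniz with respect to `x̄`, vanishing on `Λ`; it exists iff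
`Ω_{A/Λ} ⊗ κ(x̄) ≠ 0`, e.g. at every point of a smooth `Λ`-scheme of positive relative dimension).
Then the set of `Λ`-algebra lifts `x : A → W(κ)` of `x̄` is not countable: at each level
`W/pⁿ⁺² → W/pⁿ⁺¹` there are two distinct lifts (`exists_two_lifts`), the resulting binary tree of
compatible towers completes to `2^ℕ` distinct maps into the `p`-adically complete `W(κ)`, and `2^ℕ`
does not inject into `ℕ` (Cassels 1976, proof of Thm. I; Maulik–Poonen 2012, §4: "`p`-adic discs").
[cite: Cassels1976, proof of Thm. I] [cite: MaulikPoonen2012, §4] -/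
theorem not_countable_lifts_wittVector [Algebra.FormallySmooth Λ A] (xbar : A →+* κ)
    (hx : ∀ l : Λ, xbar (algebraMap Λ A l) =
      WittVector.constantCoeff (algebraMap Λ (WittVector p κ) l))
    (δ : A → κ) (hδadd : ∀ a b, δ (a + b) = δ a + δ b)
    (hδmul : ∀ a b, δ (a * b) = xbar a * δ b + xbar b * δ a)
    (hδΛ : ∀ l : Λ, δ (algebraMap Λ A l) = 0) (hδ : ∃ a, δ a ≠ 0) :
    ¬ Set.Countable {x : A →ₐ[Λ] WittVector p κ | ∀ a, (x a).coeff 0 = xbar a} := by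
  classical
  obtain ⟨a₀, ha₀⟩ := hδ
  -- level `n` data: a `Λ`-map to `W / (Ideal.span {(p : WittVector p κ)} ^ (n + 1))` reducing to `x̄`
  let Lv (n : ℕ) := {g : A →ₐ[Λ] WittVector p κ ⧸ (Ideal.span {(p : WittVector p κ)} ^ (n + 1)) //
    ∀ a w, g a = Ideal.Quotient.mk (Ideal.span {(p : WittVector p κ)} ^ (n + 1)) w → WittVector.constantCoeff w = xbar a}
  -- level 0: `x̄` itself, through `W / p ≅ κ`
  have hP0 : (Ideal.span {(p : WittVector p κ)} ^ (0 + 1)) = Ideal.span {(p : WittVector p κ)} := by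
    rw [zero_add, pow_one]
  let e₀ : WittVector p κ ⧸ (Ideal.span {(p : WittVector p κ)} ^ (0 + 1)) ≃+* κ :=
    (Ideal.quotEquivOfEq hP0).trans WittVector.quotientPEquiv
  have he₀ : ∀ w, e₀ (Ideal.Quotient.mk (Ideal.span {(p : WittVector p κ)} ^ (0 + 1)) w) = WittVector.constantCoeff w := fun w => by
    change WittVector.quotientPEquiv (Ideal.quotEquivOfEq hP0 (Ideal.Quotient.mk (Ideal.span {(p : WittVector p κ)} ^ (0 + 1)) w)) = _
    rw [Ideal.quotEquivOfEq_mk]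
    exact WittVector.quotientPEquiv_mk w
  let g₀ : A →ₐ[Λ] WittVector p κ ⧸ (Ideal.span {(p : WittVector p κ)} ^ (0 + 1)) :=
    { e₀.symm.toRingHom.comp xbar with
      commutes' := fun l => by
        change e₀.symm (xbar (algebraMap Λ A l)) =
          Ideal.Quotient.mk (Ideal.span {(p : WittVector p κ)} ^ (0 + 1)) (algebraMap Λ (WittVector p κ) l)
        rw [hx, ← he₀, RingEquiv.symm_apply_apply] }
  have hg₀ : ∀ a w, g₀ a = Ideal.Quotient.mk (Ideal.span {(p : WittVector p κ)} ^ (0 + 1)) w → WittVector.constantCoeff w = xbar a := by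
    intro a w hw
    have h1 : e₀ (g₀ a) = xbar a := e₀.apply_symm_apply _
    rw [hw, he₀] at h1
    exact h1
  -- the step functions
  have hstep : ∀ (n : ℕ) (t : Lv n), ∃ G : Bool → Lv (n + 1),
      (∀ i a, Ideal.Quotient.factor (P_le n) ((G i).1 a) = t.1 a) ∧ (G false).1 a₀ ≠ (G true).1 a₀ := by
    intro n t
    obtain ⟨G₀, G₁, h₀, h₁, hne⟩ :=
      exists_two_lifts xbar δ hδadd hδmul hδΛ ha₀ n t.1 t.2
    have h₀' : ∀ a, Ideal.Quotient.factor (P_le n) (G₀ a) = t.1 a := fun a => congr($h₀ a)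
    have h₁' : ∀ a, Ideal.Quotient.factor (P_le n) (G₁ a) = t.1 a := fun a => congr($h₁ a)
    have hr₀ : ∀ a w, G₀ a = Ideal.Quotient.mk (Ideal.span {(p : WittVector p κ)} ^ (n + 1 + 1)) w →
        WittVector.constantCoeff w = xbar a := fun a w hw =>
      t.2 a w (by rw [← h₀' a, hw]; rfl)
    have hr₁ : ∀ a w, G₁ a = Ideal.Quotient.mk (Ideal.span {(p : WittVector p κ)} ^ (n + 1 + 1)) w →
        WittVector.constantCoeff w = xbar a := fun a w hw =>
      t.2 a w (by rw [← h₁' a, hw]; rfl)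
    refine ⟨fun i => if i then ⟨G₁, hr₁⟩ else ⟨G₀, hr₀⟩, fun i a => ?_, ?_⟩
    · cases i
      · exact h₀' a
      · exact h₁' a
    · simpa using hne
  choose G hGfac hGne using hstep
  -- the tower attached to a branch `b : ℕ → Bool`
  let tower (b : ℕ → Bool) : (n : ℕ) → Lv n :=
    fun n => Nat.rec (motive := fun n => Lv n) ⟨g₀, hg₀⟩ (fun n t => G n t (b n)) n
  have htower0 : ∀ b, tower b 0 = ⟨g₀, hg₀⟩ := fun b => rfl
  have htowerS : ∀ b n, tower b (n + 1) = G n (tower b n) (b n) := fun b n => rfl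
  -- completion of each tower to a `Λ`-map `A → W(κ)`
  have ha : StrictMono (fun n : ℕ => n + 1) := fun _ _ h => Nat.succ_lt_succ h
  have hcompat : ∀ (b : ℕ → Bool) {n : ℕ},
      (Ideal.Quotient.factorPow (Ideal.span {(p : WittVector p κ)}) (ha.monotone n.le_succ)).comp
        ((tower b (n + 1)).1 : A →+* WittVector p κ ⧸ (Ideal.span {(p : WittVector p κ)} ^ (n + 1 + 1))) =
        ((tower b n).1 : A →+* WittVector p κ ⧸ (Ideal.span {(p : WittVector p κ)} ^ (n + 1))) := by
    intro b n
    rw [htowerS]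
    exact RingHom.ext fun a => hGfac n (tower b n) (b n) a
  let ψ (b : ℕ → Bool) : A →+* WittVector p κ :=
    IsAdicComplete.StrictMono.liftRingHom (Ideal.span {(p : WittVector p κ)}) ha
      (fun n => ((tower b n).1 : A →+* WittVector p κ ⧸ (Ideal.span {(p : WittVector p κ)} ^ (n + 1)))) (hcompat b)
  have hψ : ∀ b n a, Ideal.Quotient.mk (Ideal.span {(p : WittVector p κ)} ^ (n + 1)) (ψ b a) = (tower b n).1 a := fun b n a =>
    IsAdicComplete.StrictMono.mk_liftRingHom (Ideal.span {(p : WittVector p κ)}) ha _ (hcompat b) a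
  -- `ψ b` is a `Λ`-algebra map
  have hψalg : ∀ b l, ψ b (algebraMap Λ A l) = algebraMap Λ (WittVector p κ) l := by
    intro b l
    apply eq_of_sub_eq_zero
    refine IsHausdorff.haus (IsAdicComplete.toIsHausdorff
      (I := Ideal.span {(p : WittVector p κ)}) (M := WittVector p κ)) _ fun n => ?_
    rw [SModEq.zero, smul_eq_mul, Ideal.mul_top]
    have h := hψ b n (algebraMap Λ A l)
    rw [AlgHom.commutes, ← Ideal.Quotient.mk_algebraMap] at h
    have : ψ b (algebraMap Λ A l) - algebraMap Λ (WittVector p κ) l ∈ (Ideal.span {(p : WittVector p κ)} ^ (n + 1)) :=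
      Ideal.Quotient.eq.mp h
    exact Ideal.pow_le_pow_right (Nat.le_succ n) this
  let x (b : ℕ → Bool) : A →ₐ[Λ] WittVector p κ := { ψ b with commutes' := hψalg b }
  have hxmem : ∀ b, x b ∈ {x : A →ₐ[Λ] WittVector p κ | ∀ a, (x a).coeff 0 = xbar a} := by
    intro b a
    change (ψ b a).coeff 0 = xbar a
    rw [← WittVector.constantCoeff_apply]
    exact (tower b 0).2 a (ψ b a) (hψ b 0 a).symm
  -- distinct branches give distinct maps
  have hxinj : Function.Injective x := by
    intro b b' hbb'
    by_contra hne
    have hex : ∃ n, b n ≠ b' n := by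
      by_contra h
      exact hne (funext fun n => by by_contra h'; exact h ⟨n, h'⟩)
    let n := Nat.find hex
    have hn : b n ≠ b' n := Nat.find_spec hex
    have hlt : ∀ m < n, b m = b' m := fun m hm => by
      by_contra h; exact Nat.find_min hex hm h
    have heq : ∀ m ≤ n, tower b m = tower b' m := by
      intro m hm
      induction m with
      | zero => rfl
      | succ m ih =>
        rw [htowerS, htowerS, ih (by omega), hlt m (by omega)]
    have h1 : (tower b (n + 1)).1 a₀ = (tower b' (n + 1)).1 a₀ := by
      rw [← hψ b (n + 1) a₀, ← hψ b' (n + 1) a₀]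
      exact congrArg (fun f : A →ₐ[Λ] WittVector p κ => Ideal.Quotient.mk (Ideal.span {(p : WittVector p κ)} ^ (n + 1 + 1)) (f a₀)) hbb'
    rw [htowerS, htowerS, heq n le_rfl] at h1
    have key := hGne n (tower b' n)
    revert h1 hn
    cases b n <;> cases b' n <;> intro hn h1
    · exact hn rfl
    · exact key h1
    · exact key h1.symm
    · exact hn rfl
  -- Cantor
  intro hc
  obtain ⟨f, hf⟩ := Set.countable_iff_exists_injective.mp hc
  let g : Set ℕ → {x : A →ₐ[Λ] WittVector p κ | ∀ a, (x a).coeff 0 = xbar a} :=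
    fun S => ⟨x (fun n => decide (n ∈ S)), hxmem _⟩
  have hg : Function.Injective g := by
    intro S T hST
    have h := hxinj (congrArg Subtype.val hST)
    ext n
    have hn := congrFun h n
    simp only [decide_eq_decide] at hn
    exact hn
  exact Function.cantor_injective (f ∘ g) (hf.comp hg)

end Disc

end Literature.RingTheory.CompleteLocalRings

end
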